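import Literature.AnabelianGeometry.SemiGraphs.GaloisLevelDataOfCharCores
import Literature.AnabelianGeometry.SemiGraphs.TemperedCosetTowerNoFixedBranchPairChart
import HarnessLib

/-!
# The CHARACTERISTIC Galois tower `GaloisLevelData.ofCharCores`: fibre stabilisers, connected levels, domination
# of the enumerated tower, and (I0v) — the tower-side inputs of the T54-B capstone v3 at that tower

Mochizuki, *Semi-graphs of anabelioids*, Publ. RIMS **42** (2006) 221–322, §3 Prop 3.6 p. 38 ("`π₁^temp(G)` …
independent, up to inner automorphism, of the choice of the cofinal system"), Ex 3.10 p. 44 ("an exhaustive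
sequence of open characteristic subgroups of finite index"), Thm 3.7 (i) p. 40 [cite: MochizukiSemiAnbd2006, Prop 3.6 p.38].

PROOF-ONLY file (abc-iut cell, layer L3, producer row T54-B = `plan/GAP-LEDGER.md` G-w4d053-1; seat
abc-iut-w4-d029 gen 4, «T54·CAPSTONE-v3@char-tower», STEP 2c inputs).  No definition, no new named fact.
For abc-iut-w4-d048's characteristic tower `GaloisLevelData.ofCharCores h36 v₀ hVt hEt`
(GaloisLevelDataOfCharCores.lean: levels `𝒢_{charOpenCore (Aut (𝒢.fiberAt v₀)) k}` of a FINITE semi-graph of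
anabelioids with topologically finitely generated constituents):

* `stabilizer_eq_charOpenCore_of_charCoreObj` — EVERY point of the `v₀`-fibre of the `k`-th characteristic
  covering has `Aut`-stabiliser `charOpenCore _ k` (transitivity of `Aut F` on the fibre of the connected Galois
  level + normality; the pattern of abc-iut-L3-t9's `stabilizer_eq_of_openNormalObj`) — the point-stabiliser
  input of abc-iut-L3-t9's `ker_piLevelAut_ofGaloisSeq_eq_charOpenCore` (ArithTowerCharacteristicLevels.lean);
* `ofCharCores_sameComponent` — the levels are connected coverings (the `hconn` input of `piLevelAut`);
* `ofCharCores_dominates` — every level of the enumerated tower `𝒢.galoisLevelData h36` receives a morphism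
  from some characteristic level which is ONTO on every vertex fibre (abc-iut-w4-d048's
  `ofSubgroupSeq_dominates` + abc-iut-L3-t9's `ofBObj_map_fV_surjective_of_isGalois`);
* **`faithfulV_ofCharCores`** — (I0v) for the characteristic tower: every `𝒢_v` acts faithfully on the
  `v`-fibres of its levels (abc-iut-w4-d053's `GaloisLevelData.faithfulV_of_dominates` over abc-iut-L3-t6's
  `galoisLevelData_faithfulV`) — the `hfaithV` input of `hnobpNCpt_cosetTower_of_faithV_chart` /
  `arithMaximalCompactStatement_outerAction_piPresentation_chart_of_producers` at this tower.

Nothing here takes a side on [IUTchIII] Cor. 3.12; typed ≠ proved elsewhere.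
-/

namespace Literature.AnabelianGeometry.SemiGraphs

namespace ProfiniteSemiGraph

open CategoryTheory CategoryTheory.PreGaloisCategory Topology Literature.AnabelianGeometry.Anabelioids
open Literature.AnabelianGeometry.AbsoluteAnabelian (IsTopologicallyFinitelyGenerated)
open scoped FintypeCatDiscrete

universe u

variable {𝒢 : ProfiniteSemiGraph.{u}} [Finite 𝒢.graph.Vertex] [Finite 𝒢.graph.Branch]
  (h36 : 𝒢.Prop36Hypotheses) (v₀ : 𝒢.graph.Vertex)
  (hVt : ∀ v : 𝒢.graph.Vertex, IsTopologicallyFinitelyGenerated (𝒢.Gv v))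
  (hEt : ∀ e : 𝒢.graph.Edge, IsTopologicallyFinitelyGenerated (𝒢.Ge e))

/-- The characteristic level objects are Galois (abc-iut-w4-d048's `isGalois_seqObj` at the characteristic
open cores). [cite: MochizukiSemiAnbd2006, Ex 3.10 p.44] -/
theorem isGalois_charCoreObj (k : ℕ) :
    letI := SemiGraphOfAnabelioids.galoisCategory_bObj 𝒢.toAnab ⟨h36.isConnected⟩
    IsGalois (charCoreObj h36 v₀ hVt hEt k) :=
  isGalois_seqObj h36.isConnected v₀ _ (isOpen_charOpenCore_autFiberAt h36 v₀ hVt hEt)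
    (finiteIndex_charOpenCore_autFiberAt h36 v₀ hVt hEt) (fun k => charOpenCore_normal k) k

/-- **Every point of the `v₀`-fibre of the `k`-th characteristic covering has stabiliser
`charOpenCore (Aut (𝒢.fiberAt v₀)) k`** (`Aut F` is transitive on the fibre of the connected level, the base
point has that stabiliser, and the characteristic open core is normal). [cite: DixonEtAl1999, Prop 1.6] -/
theorem stabilizer_eq_charOpenCore_of_charCoreObj (k : ℕ)
    (x : (𝒢.fiberAt v₀).obj (charCoreObj h36 v₀ hVt hEt k)) :
    MulAction.stabilizer (Aut (𝒢.fiberAt v₀)) x = charOpenCore (Aut (𝒢.fiberAt v₀)) k := by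
  letI := SemiGraphOfAnabelioids.galoisCategory_bObj 𝒢.toAnab ⟨h36.isConnected⟩
  haveI := 𝒢.fiberFunctor_fiberAt h36.isConnected v₀
  haveI := finiteIndex_charOpenCore_autFiberAt h36 v₀ hVt hEt k
  haveI : MulAction.IsPretransitive (Aut (𝒢.fiberAt v₀)) ((𝒢.fiberAt v₀).obj (charCoreObj h36 v₀ hVt hEt k)) :=
    isPretransitive_fiber_objOfSubgroup h36.isConnected (charOpenCore (Aut (𝒢.fiberAt v₀)) k)
      (isOpen_charOpenCore_autFiberAt h36 v₀ hVt hEt k)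
  obtain ⟨σ, rfl⟩ := MulAction.exists_smul_eq (α := (𝒢.fiberAt v₀).obj (charCoreObj h36 v₀ hVt hEt k))
    (Aut (𝒢.fiberAt v₀))
    (@basePt 𝒢 h36.isConnected v₀ (charOpenCore (Aut (𝒢.fiberAt v₀)) k)
      (isOpen_charOpenCore_autFiberAt h36 v₀ hVt hEt k) (finiteIndex_charOpenCore_autFiberAt h36 v₀ hVt hEt k) :
        (𝒢.fiberAt v₀).obj (charCoreObj h36 v₀ hVt hEt k)) x
  rw [MulAction.stabilizer_smul_eq_stabilizer_map_conj]
  refine (congrArg (Subgroup.map (MulAut.conj σ).toMonoidHom)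
    (stabilizer_basePt_charCoreObj h36 v₀ hVt hEt k)).trans ?_
  have hN : (charOpenCore (Aut (𝒢.fiberAt v₀)) k).Normal := charOpenCore_normal k
  ext τ
  simp only [Subgroup.mem_map, MulEquiv.coe_toMonoidHom, MulAut.conj_apply]
  constructor
  · rintro ⟨y, hy, rfl⟩
    exact hN.conj_mem y hy σ
  · intro hτ
    refine ⟨σ⁻¹ * τ * σ, ?_, by group⟩
    have h := hN.conj_mem τ hτ σ⁻¹
    rwa [inv_inv] at h

/-- **The levels of the characteristic tower are connected coverings** (the `hconn` input of
`GaloisLevelData.piLevelAut`). [cite: MochizukiSemiAnbd2006, Prop 3.6(i) p.38] -/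
theorem ofCharCores_sameComponent (k : ℕ)
    (p q : ((GaloisLevelData.ofCharCores h36 v₀ hVt hEt).S k).Point) :
    ((GaloisLevelData.ofCharCores h36 v₀ hVt hEt).S k).SameComponent p q :=
  letI := SemiGraphOfAnabelioids.galoisCategory_bObj 𝒢.toAnab ⟨h36.isConnected⟩
  sameComponent_ofBObj_of_isConnected h36.isConnected (charCoreObj h36 v₀ hVt hEt k)
    (isGalois_charCoreObj h36 v₀ hVt hEt k).toIsConnected p q

/-- **The characteristic tower dominates the enumerated tower through fibre-surjective maps**: every level
`𝒢_{∞,i}` of `𝒢.galoisLevelData h36` receives, from some characteristic level, a morphism of coverings that is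
onto on every vertex fibre (epimorphism between connected Galois objects). [cite: MochizukiSemiAnbd2006, Prop 3.6 p.38] -/
theorem ofCharCores_dominates (i : ℕ) :
    ∃ (k : ℕ) (f : (GaloisLevelData.ofCharCores h36 v₀ hVt hEt).S k ⟶ (𝒢.galoisLevelData h36).S i),
      ∀ v, Function.Surjective (f.fV v).hom.hom := by
  letI := SemiGraphOfAnabelioids.galoisCategory_bObj 𝒢.toAnab ⟨h36.isConnected⟩
  obtain ⟨k, ⟨f⟩⟩ := ofSubgroupSeq_dominates v₀ h36 (fun k => charOpenCore (Aut (𝒢.fiberAt v₀)) k)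
    (isOpen_charOpenCore_autFiberAt h36 v₀ hVt hEt) (finiteIndex_charOpenCore_autFiberAt h36 v₀ hVt hEt)
    (fun k => charOpenCore_normal k) (fun _ _ h => charOpenCore_anti h)
    (fun U hU hUi => (charOpenCore_autFiberAt_family 𝒢 h36.isConnected v₀ hVt hEt).2.2 U hU hUi) i
  refine ⟨k, f, fun v => ?_⟩
  have hf : 𝒢.ofBObj.map (𝒢.ofBObj.preimage f) = f := 𝒢.ofBObj.map_preimage f
  rw [← hf]
  exact 𝒢.ofBObj_map_fV_surjective_of_isGalois h36.isConnected (isGalois_charCoreObj h36 v₀ hVt hEt k)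
    (𝒢.isGalois_tower h36 i) _ v

/-- **(I0v) for the characteristic tower**: every vertex group `𝒢_v` acts faithfully on the `v`-fibres of the
characteristic levels (abc-iut-w4-d053's `faithfulV_of_dominates` fed with `ofCharCores_dominates` and
abc-iut-L3-t6's `galoisLevelData_faithfulV` for the enumerated tower, Thm 3.7 (i)).
[cite: MochizukiSemiAnbd2006, Thm 3.7(i) p.40] -/
theorem faithfulV_ofCharCores (h37 : 𝒢.Thm37Hypotheses)
    (hVt' : ∀ v : 𝒢.graph.Vertex, IsTopologicallyFinitelyGenerated (𝒢.Gv v))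
    (hEt' : ∀ e : 𝒢.graph.Edge, IsTopologicallyFinitelyGenerated (𝒢.Ge e)) :
    ∀ (v : 𝒢.graph.Vertex) (h : 𝒢.Gv v),
      (∀ (k : ℕ) (y : (((GaloisLevelData.ofCharCores h37.toProp36Hypotheses v₀ hVt' hEt').S k).SV v).obj.V),
        (((GaloisLevelData.ofCharCores h37.toProp36Hypotheses v₀ hVt' hEt').S k).SV v).obj.ρ h y = y) → h = 1 :=
  GaloisLevelData.faithfulV_of_dominates (𝒢.galoisLevelData h37.toProp36Hypotheses) _
    (fun i => ofCharCores_dominates h37.toProp36Hypotheses v₀ hVt' hEt' i)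
    (fun v h hfix => 𝒢.galoisLevelData_faithfulV h37 v h hfix)

end ProfiniteSemiGraph

end Literature.AnabelianGeometry.SemiGraphs
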